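import Summits.BirchSwinnertonDyer.Rank1Residual.X11b.HalvesReceptacle
import Mathlib.RingTheory.PowerSeries.Binomial
import Mathlib.NumberTheory.Padics.MahlerBasis
import Mathlib.Analysis.Normed.Ring.InfiniteSum
import HarnessLib

/-!
# X11b, S23 (glue (g2) of the S18 frame), part 1: values of `R₀⟦T⟧` on the open unit disc of `ℂ_p`
# (product rule) and the twist `(1 + T)^a`, `a ∈ ℤ_p`, in the receptacle `R₀⟦T⟧` (every prime `p`;
# theorems only)

HONEST FRAMING (cell `b2b-bsdres`, run/shared/lean/b2b/bsd-rank1-residual/, verbatim in every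
file): the goal of the cell is to DELETE the COMBINATION-SHAPED residual classes of the
Birch–Swinnerton-Dyer formula for ALL analytic-rank `≤ 1` elliptic curves over `ℚ` — "full BSD
formula for every rank `≤ 1` curve in class `C`" assembled STRICTLY from published theorems — so
that the rank-`≤ 1` remainder becomes exactly the CONSTRUCTION-SHAPED classes, which are TYPED
(missing-input `Prop`s), NOT attempted. This is not "finishing BSD". Team `x11b3` = N8/O2 (X11b at
`p = 3`: `3 ‖ N`, `r_an = 1`, `E[3]` irreducible): RESEARCH ROUTES; published theorems only; the
construction-shaped remainder is TYPED, not attempted; census output = EVIDENCE, never a Literature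
fact; nothing booked; no label change; O2 stays OPEN; no route opened.

PROVENANCE (team `cells/x11b3/`, LEAD DEAL #7 R7-37, sub-target S23 = glue (g2) of route planner 2's
frame memo `HOME/b2b-bsdres-x11b3-r2/gen6/D3EPS.md` §4.1, seat `b2b-bsdres-x11b3-p3` gen. 4). The
S18 re-normalisation `L ↦ c₀⁻¹ · (1 + T)^{-b} · L` of an element of `Λ_{R₀} = R₀⟦T⟧` (D3EPS §0, §3)
translates `L` by the `Λ`-unit `(1 + T)^{-b}` with `b ∈ ℤ_p` (NOT only `b ∈ ℕ`: `b = κ(g_𝔭̄)`,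
`κ(σ_𝔉)` are `p`-adic integers), and reads values at `T = u - 1`, `u = φ̂(γ) ∈ 1 + 𝔪_{ℂ_p}`:
`((1 + T)^a · L)(u - 1) = u^a · L(u - 1)`. This file and its sequel `UnrSeriesTwistCharacter.lean`
supply exactly that, for EVERY prime `p`, in the currency of
`Literature/NumberTheory/EllipticCurves/BDPAnticyclotomicPAdicLFunction.lean` (`UnrSeries p = R₀⟦T⟧`,
`UnrSeries.HasValueAt`) and of `X11b/HalvesReceptacle.lean` (`Halves.toUnr : ℤ_[p] →+* unrIntegers p`),
WITHOUT any new definition: **`(1 + T)^a ∈ R₀⟦T⟧` for `a ∈ ℤ_p` is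
`(PowerSeries.binomialSeries ℤ_[p] a).map (Halves.toUnr p)`** — Mathlib's binomial power series
`∑_k C(a, k) T^k` over the binomial ring `ℤ_p` (`PadicInt.instBinomialRing`, `Ring.choose`),
base-changed along `ℤ_p ⊆ R₀`. (The value side — `u^a := χ(a)` for the continuous additive character
`χ : ℤ_p → ℂ_p` with `χ(1) = u`, and the `κ`-bridge for avatars — is the sequel.)

## What is kernel-checked here (THEOREMS only; no definition, no fact, no hypothesis shape)

* §1 values of `R₀⟦T⟧` on the open unit disc `‖x‖ < 1` of `ℂ_p`: every `L` converges ABSOLUTELY there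
  (`‖[T^k]L · x^k‖ ≤ ‖x‖^k`), `exists_hasValueAt`, and the PRODUCT RULE **`hasValueAt_mul`**:
  `L(x) = v ∧ M(x) = w ⟹ (L·M)(x) = v·w` (Mathlib's Cauchy product in the complete field `ℂ_p`);
  scaling by constants `hasValueAt_C_mul` (glue (g4): `L ↦ c₀⁻¹ L`); `hasValueAt_one`;
* §2 the binomial series in `R₀⟦T⟧`: coefficients (`C(a,k)`; `Nat.choose` for `a ∈ ℕ`, `Ring.choose`
  over `ℤ` for `a ∈ ℤ`), **`binomialSeries_map_add`** `(1+T)^{a+b} = (1+T)^a (1+T)^b`, `(1+T)^n` for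
  `n ∈ ℕ` is the polynomial, `(1+T)^{-a} (1+T)^a = 1` (`isUnit_binomialSeries_map`: a `Λ_{R₀}`-unit, so
  translation does not change the ideal `(L)`), values `(1 + x)^n` and `((1 + x)^n)⁻¹` at `a = ± n`.

## What this does NOT do
No `p`-adic `L`-function is constructed or re-normalised here; nothing is asserted about elliptic
curves or Hecke characters. Nothing is booked; no label changes; O2 stays OPEN.

References: [Castella2018] §2.2 ("we identify `ℤ_p⟦T⟧` with `Λ` by `1 + T ↦ γ`"), Thm. 3.1
(arXiv:1704.06608 pp. 5, 9); D3EPS.md §0/§3/§4.1 (r2 gen. 6, sha16 25d7c5f721ee6066); Mathlib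
`RingTheory/PowerSeries/Binomial`, `NumberTheory/Padics/MahlerBasis` (the binomial ring `ℤ_p`),
`Analysis/Normed/Ring/InfiniteSum` (Cauchy product).
-/

noncomputable section

open Filter Topology PowerSeries
open Literature.NumberTheory.EllipticCurves

namespace Summit.BirchSwinnertonDyer.Rank1Residual.X11b.Halves

variable {p : ℕ} [Fact p.Prime]

/-! ## §1 Values of `R₀⟦T⟧` on the open unit disc of `ℂ_p` (every prime `p`) -/

section Values

/-- The `k`-th term of `L(x)` has norm `≤ ‖x‖^k` (`R₀ ⊆ {‖·‖ ≤ 1}`). [folklore] -/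
theorem norm_coeff_mul_pow_le (L : UnrSeries p) (x : ℂ_[p]) (k : ℕ) :
    ‖((coeff k L : unrIntegers p) : ℂ_[p]) * x ^ k‖ ≤ ‖x‖ ^ k := by
  rw [norm_mul, norm_pow]
  exact mul_le_of_le_one_left (pow_nonneg (norm_nonneg _) _) (norm_coe_unrIntegers_le_one p _)

/-- On the open unit disc `‖x‖ < 1` every `L ∈ R₀⟦T⟧` converges ABSOLUTELY (geometric bound).
[folklore] -/
theorem summable_norm_coeff_mul_pow (L : UnrSeries p) {x : ℂ_[p]} (hx : ‖x‖ < 1) :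
    Summable fun k : ℕ ↦ ‖((coeff k L : unrIntegers p) : ℂ_[p]) * x ^ k‖ :=
  (summable_geometric_of_lt_one (norm_nonneg x) hx).of_nonneg_of_le (fun _ ↦ norm_nonneg _)
    (norm_coeff_mul_pow_le L x)

/-- On the open unit disc the value of `L` exists and is the sum of the series. [folklore] -/
theorem hasValueAt_tsum (L : UnrSeries p) {x : ℂ_[p]} (hx : ‖x‖ < 1) :
    L.HasValueAt x (∑' k : ℕ, ((coeff k L : unrIntegers p) : ℂ_[p]) * x ^ k) :=
  (summable_norm_coeff_mul_pow L hx).of_norm.hasSum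

/-- On the open unit disc every `L ∈ R₀⟦T⟧` has a value. [folklore] -/
theorem exists_hasValueAt (L : UnrSeries p) {x : ℂ_[p]} (hx : ‖x‖ < 1) :
    ∃ v : ℂ_[p], L.HasValueAt x v :=
  ⟨_, hasValueAt_tsum L hx⟩

/-- **Product rule** for values in the open unit disc: `L(x) = v` and `M(x) = w` imply
`(L · M)(x) = v · w` (Cauchy product of two absolutely convergent series in the complete field
`ℂ_p`; `[T^n](L·M) = ∑_{k+l=n} [T^k]L · [T^l]M`). [folklore] -/
theorem hasValueAt_mul {L M : UnrSeries p} {x v w : ℂ_[p]} (hx : ‖x‖ < 1) (hL : L.HasValueAt x v)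
    (hM : M.HasValueAt x w) : UnrSeries.HasValueAt (L * M) x (v * w) := by
  set f : ℕ → ℂ_[p] := fun k ↦ ((coeff k L : unrIntegers p) : ℂ_[p]) * x ^ k with hf
  set g : ℕ → ℂ_[p] := fun k ↦ ((coeff k M : unrIntegers p) : ℂ_[p]) * x ^ k with hg
  have hL' : HasSum f v := hL
  have hM' : HasSum g w := hM
  have hfn : Summable fun k ↦ ‖f k‖ := summable_norm_coeff_mul_pow L hx
  have hgn : Summable fun k ↦ ‖g k‖ := summable_norm_coeff_mul_pow M hx
  have hsum : HasSum (fun n ↦ ∑ kl ∈ Finset.HasAntidiagonal.antidiagonal n, f kl.1 * g kl.2)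
      (v * w) := by
    rw [← hL'.tsum_eq, ← hM'.tsum_eq, tsum_mul_tsum_eq_tsum_sum_antidiagonal_of_summable_norm hfn hgn]
    exact (summable_norm_sum_mul_antidiagonal_of_summable_norm hfn hgn).of_norm.hasSum
  have hterm : (fun n ↦ ∑ kl ∈ Finset.HasAntidiagonal.antidiagonal n, f kl.1 * g kl.2) =
      fun n ↦ ((coeff n (L * M) : unrIntegers p) : ℂ_[p]) * x ^ n := by
    funext n
    rw [coeff_mul, AddSubmonoidClass.coe_finsetSum, Finset.sum_mul]
    refine Finset.sum_congr rfl fun kl hkl ↦ ?_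
    rw [Finset.HasAntidiagonal.mem_antidiagonal] at hkl
    simp only [hf, hg, Subring.coe_mul, ← hkl, pow_add]
    ring
  rw [hterm] at hsum
  exact hsum

/-- Scaling by a constant of `R₀` (glue (g4): `L ↦ c₀⁻¹ L`): `(C c · L)(x) = c · L(x)`, any `x`.
[folklore] -/
theorem hasValueAt_C_mul {L : UnrSeries p} {x v : ℂ_[p]} (c : unrIntegers p)
    (hL : L.HasValueAt x v) : UnrSeries.HasValueAt (C c * L) x ((c : ℂ_[p]) * v) := by
  have h := HasSum.mul_left (c : ℂ_[p]) hL
  have hfun : (fun k : ℕ ↦ ((coeff k (C c * L) : unrIntegers p) : ℂ_[p]) * x ^ k) =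
      fun k ↦ (c : ℂ_[p]) * (((coeff k L : unrIntegers p) : ℂ_[p]) * x ^ k) := by
    funext k
    rw [coeff_C_mul, Subring.coe_mul, mul_assoc]
  unfold UnrSeries.HasValueAt
  rw [hfun]
  exact h

/-- The constant series `1` has value `1` everywhere. [folklore] -/
theorem hasValueAt_one (x : ℂ_[p]) : UnrSeries.HasValueAt (1 : UnrSeries p) x 1 := by
  have h := hasSum_single (f := fun k : ℕ ↦
    ((coeff k (1 : UnrSeries p) : unrIntegers p) : ℂ_[p]) * x ^ k) 0
    (fun k hk ↦ by rw [coeff_one, if_neg hk, Subring.coe_zero, zero_mul])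
  simpa [UnrSeries.HasValueAt, coeff_one] using h

/-- A point of the open unit disc is `u - 1` for a UNIT `u = 1 + x` (`‖x‖ < 1 = ‖1‖`). [folklore] -/
theorem one_add_ne_zero_of_norm_lt_one {x : ℂ_[p]} (hx : ‖x‖ < 1) : 1 + x ≠ 0 := by
  intro h
  have hx1 : x = -1 := eq_neg_of_add_eq_zero_right h
  rw [hx1, norm_neg, norm_one] at hx
  exact lt_irrefl _ hx

end Values

/-! ## §2 The binomial series `(1 + T)^a`, `a ∈ ℤ_p`, in `R₀⟦T⟧` (every prime `p`) -/

section Binomial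

/-- `[T^k] (1 + T)^a = C(a, k) ∈ ℤ_p ⊆ R₀` (`Ring.choose` of the binomial ring `ℤ_p`). [folklore] -/
theorem coeff_binomialSeries_map (a : ℤ_[p]) (k : ℕ) :
    coeff k ((binomialSeries ℤ_[p] a).map (toUnr p)) = toUnr p (Ring.choose a k) := by
  rw [coeff_map, binomialSeries_coeff, smul_eq_mul, mul_one]

/-- `[T^k] (1 + T)^a`, read in `ℂ_p`, is the image of `C(a, k) ∈ ℤ_p ⊂ ℚ_p`. [folklore] -/
theorem coe_coeff_binomialSeries_map (a : ℤ_[p]) (k : ℕ) :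
    ((coeff k ((binomialSeries ℤ_[p] a).map (toUnr p)) : unrIntegers p) : ℂ_[p]) =
      algebraMap ℚ_[p] ℂ_[p] ((Ring.choose a k : ℤ_[p]) : ℚ_[p]) := by
  rw [coeff_binomialSeries_map, coe_toUnr]

/-- Sanity (`a ∈ ℕ`): `[T^k] (1 + T)^n = Nat.choose n k`. [folklore] -/
theorem coeff_binomialSeries_map_natCast (n k : ℕ) :
    coeff k ((binomialSeries ℤ_[p] (n : ℤ_[p])).map (toUnr p)) = (n.choose k : unrIntegers p) := by
  rw [coeff_binomialSeries_map, Ring.choose_natCast, map_natCast]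

/-- Sanity (`a ∈ ℤ`): `[T^k] (1 + T)^n = Ring.choose n k` computed in the binomial ring `ℤ`
(so for negative `n` these are the usual signed binomial coefficients). [folklore] -/
theorem coeff_binomialSeries_map_intCast (n : ℤ) (k : ℕ) :
    coeff k ((binomialSeries ℤ_[p] (n : ℤ_[p])).map (toUnr p)) =
      ((Ring.choose n k : ℤ) : unrIntegers p) := by
  have h := Ring.map_choose (Int.castRingHom ℤ_[p]) n k
  rw [eq_intCast, eq_intCast] at h
  rw [coeff_binomialSeries_map, ← h, map_intCast]

/-- Sanity (`a ∈ ℕ`): `(1 + T)^n` is the polynomial `(1 + T)^n` of `R₀⟦T⟧`. [folklore] -/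
theorem binomialSeries_map_natCast (n : ℕ) :
    (binomialSeries ℤ_[p] (n : ℤ_[p])).map (toUnr p) = (1 + X) ^ n := by
  rw [binomialSeries_nat, map_pow, map_add, map_one, map_X]

/-- `(1 + T)^0 = 1`. [folklore] -/
theorem binomialSeries_map_zero : (binomialSeries ℤ_[p] (0 : ℤ_[p])).map (toUnr p) = 1 := by
  rw [binomialSeries_zero, map_one]

/-- **`(1 + T)^{a + b} = (1 + T)^a · (1 + T)^b`** in `R₀⟦T⟧` for `a, b ∈ ℤ_p` (Chu–Vandermonde in
the binomial ring `ℤ_p`, Mathlib `PowerSeries.binomialSeries_add`). [folklore] -/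
theorem binomialSeries_map_add (a b : ℤ_[p]) :
    (binomialSeries ℤ_[p] (a + b)).map (toUnr p) =
      (binomialSeries ℤ_[p] a).map (toUnr p) * (binomialSeries ℤ_[p] b).map (toUnr p) := by
  rw [binomialSeries_add, map_mul]

/-- `(1 + T)^{-a} · (1 + T)^a = 1`: `(1 + T)^a` is a unit of `Λ_{R₀}` with inverse `(1 + T)^{-a}`.
[folklore] -/
theorem binomialSeries_map_neg_mul (a : ℤ_[p]) :
    (binomialSeries ℤ_[p] (-a)).map (toUnr p) * (binomialSeries ℤ_[p] a).map (toUnr p) = 1 := by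
  rw [← binomialSeries_map_add, neg_add_cancel, binomialSeries_map_zero]

/-- `(1 + T)^a` is a unit of `Λ_{R₀} = R₀⟦T⟧` (translation by it does not change the ideal `(L)`).
[folklore] -/
theorem isUnit_binomialSeries_map (a : ℤ_[p]) :
    IsUnit ((binomialSeries ℤ_[p] a).map (toUnr p)) :=
  ⟨⟨(binomialSeries ℤ_[p] a).map (toUnr p), (binomialSeries ℤ_[p] (-a)).map (toUnr p),
    by simpa only [neg_neg] using binomialSeries_map_neg_mul (p := p) (-a),
    binomialSeries_map_neg_mul a⟩, rfl⟩

/-- Sanity (`a = -n`, `n ∈ ℕ`): `(1 + T)^{-n} · (1 + T)^n = 1` with the POLYNOMIAL `(1 + T)^n`.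
[folklore] -/
theorem binomialSeries_map_neg_natCast_mul (n : ℕ) :
    (binomialSeries ℤ_[p] (-(n : ℤ_[p]))).map (toUnr p) * (1 + X) ^ n = 1 := by
  rw [← binomialSeries_map_natCast, binomialSeries_map_neg_mul]

/-- Sanity value (`a = n ∈ ℕ`): `(1 + T)^n (x) = (1 + x)^n` at every `x ∈ ℂ_p` (finite binomial
sum). [folklore] -/
theorem hasValueAt_binomialSeries_natCast (n : ℕ) (x : ℂ_[p]) :
    UnrSeries.HasValueAt ((binomialSeries ℤ_[p] (n : ℤ_[p])).map (toUnr p)) x ((1 + x) ^ n) := by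
  set B : UnrSeries p := (binomialSeries ℤ_[p] (n : ℤ_[p])).map (toUnr p) with hB
  have hcoe : ∀ k, ((coeff k B : unrIntegers p) : ℂ_[p]) = (n.choose k : ℂ_[p]) := fun k ↦ by
    rw [hB, coeff_binomialSeries_map_natCast, Subring.coe_natCast]
  have hfin : HasSum (fun k : ℕ ↦ ((coeff k B : unrIntegers p) : ℂ_[p]) * x ^ k)
      (∑ k ∈ Finset.range (n + 1), ((coeff k B : unrIntegers p) : ℂ_[p]) * x ^ k) :=
    hasSum_sum_of_ne_finset_zero fun k hk ↦ by
      have hnk : n < k := by simpa [Finset.mem_range, Nat.lt_succ_iff] using hk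
      rw [hcoe, Nat.choose_eq_zero_of_lt hnk, Nat.cast_zero, zero_mul]
  have hval : ∑ k ∈ Finset.range (n + 1), ((coeff k B : unrIntegers p) : ℂ_[p]) * x ^ k =
      (1 + x) ^ n := by
    rw [add_comm (1 : ℂ_[p]) x, add_pow]
    refine Finset.sum_congr rfl fun k _ ↦ ?_
    rw [hcoe, one_pow, mul_one, mul_comm]
  unfold UnrSeries.HasValueAt
  rw [← hval]
  exact hfin

/-- The polynomial `(1 + T)^n` of `R₀⟦T⟧` has value `(1 + x)^n` at every `x ∈ ℂ_p`. [folklore] -/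
theorem hasValueAt_one_add_X_pow (n : ℕ) (x : ℂ_[p]) :
    UnrSeries.HasValueAt ((1 + X : UnrSeries p) ^ n) x ((1 + x) ^ n) := by
  rw [← binomialSeries_map_natCast]
  exact hasValueAt_binomialSeries_natCast n x

/-- Sanity value (`a = -n`, `n ∈ ℕ`): on the open unit disc `(1 + T)^{-n} (x) = ((1 + x)^n)⁻¹`
(from the product rule and `(1 + T)^{-n} (1 + T)^n = 1`; `1 + x ≠ 0` there). [folklore] -/
theorem hasValueAt_binomialSeries_neg_natCast (n : ℕ) {x : ℂ_[p]} (hx : ‖x‖ < 1) :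
    UnrSeries.HasValueAt ((binomialSeries ℤ_[p] (-(n : ℤ_[p]))).map (toUnr p)) x
      ((1 + x) ^ n)⁻¹ := by
  obtain ⟨v, hv⟩ := exists_hasValueAt ((binomialSeries ℤ_[p] (-(n : ℤ_[p]))).map (toUnr p)) hx
  have hprod := hasValueAt_mul hx hv (hasValueAt_binomialSeries_natCast n x)
  rw [binomialSeries_map_neg_mul] at hprod
  have h1 : v * (1 + x) ^ n = 1 := hprod.unique (hasValueAt_one x)
  rwa [eq_inv_of_mul_eq_one_left h1] at hv

end Binomial

end Summit.BirchSwinnertonDyer.Rank1Residual.X11b.Halves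

end
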